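import Summits.QuantumFields.BalabanUV.Beta.FP.CoarseCovarianceAlias
import Summits.QuantumFields.BalabanUV.Beta.GAN24.AliasStripSymbolsSum
import Literature.MathematicalPhysics.QuantumFieldTheory.Balaban1983to89.Beta.AliasRatioStrip

/-!
# `BalabanUV.Beta.FP.CoarseCovarianceStripAliasWeights` — road «FP» (binder row D1), row H′2-IR ∕ IR-2 (ii) «STRIP STRUCTURE OF THE COARSE
# COVARIANCE SYMBOL», slice (Alias-W): **the alias-weight identity `cweight·cweight(−) = n^{2D}·U·gsum·gsum(−)` and the `P̂`-free alias majorant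
# `Σ_l ‖cweight n κ (k_l)‖·‖cweight n λ (−k_l)‖ ≤ 132^D · e^{2κ} · n^{2D+2}` on the fat strip**

HONEST FRAMING (cell contract, verbatim): «discharging `BetaPertH` makes Bałaban's UV stability UNCONDITIONAL — a real constructive-QFT
result; it is NOT the continuum limit and NOT the Clay problem.»  HONEST DEPENDENCY (verbatim): «continuum YM on T⁴ ⇐ BetaPertH ∧ nine
spine estimates (0/9 proved); BetaPertH ⇐ (D1) ∧ (D4) ∧ CAP+tail; G-an2-4 gates asym, D1 and NE2/3/4.»  THIS MODULE DISCHARGES NOTHING of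
D1 ∕ BetaPertH: [folklore] trigonometric ∕ geometric-sum bookkeeping on the cell's OWN `U = 1` alias weights (`GAN24.PushSumSymbol.cweight`,
`GAN24.FibreSymbols.gsum`, `GAN24.AliasDecimate.aliasPt`) against the Literature B4 letters `uFactor` ∕ `U` ∕ `Sxi` ∕ `S1` BY NAME
(`B4StripCauchy.Sxi_shift_ne_zero`, `Sxi_ne_zero`, `sum_norm_U_le`; `Beta.AliasRatioStrip.norm_uFactor_zero_ge`; `GAN24.AliasStripSymbolsSum.gsum_mul_sub_one`,
`norm_gsum_le_of_im`).
No `def`, no `def … : Prop`, nothing is cited, 0 sorry.  NOT IR-2 (ii); NOT summit progress; NOT BetaPertH, NOT continuum, NOT Clay.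

ABSOLUTE RULE (cell, verbatim): «No internally-minted statement may enter as a cited fact. Every hypothesis is either kernel-proved in this
package or a verbatim quotation of a PUBLISHED theorem with page reference. The manuscript(s) under audit are NOT citable for their own
disputed steps — they are the thing under adjudication; programme-internal (2001/route/tribunal) claims are never citable.»

WHY (leaf-06-g7's successor recipe `HOME/b2b-balaban-beta-d1-formalise-leaf-06/STATUS.md` § «For a successor (gen 8)» step (2) items (a)(b)(c) and the
WEIGHT half of (g), plus (d); journal INTENT l.22834 of unit `b2b-balaban-t4-ne9-formalise-leaf-04-g35`).  The alias sum of the coarse covariance symbol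
`Ĉ_n(k) = n^{−(3D+2)} Σ_{l ∈ {0,…,n−1}^D} cweight n κ (k_l)·cweight n λ (−k_l)·P̂(k_l)_{κλ}`, `k_l = (k + 2πl)/n` (`CoarseCovarianceAlias.covSymMean_apply`), is split
in step (3) of that recipe into the `l = 0` term and the remainder `Ftil`.  The two facts about the WEIGHTS needed there are (b) the exact factorisation
of `cweight·cweight(−)` through Bałaban's averaging letter `U n l k = Π_i uFactor n (l_i) (k_i)` ((2.45)–(2.48), Literature `B4Strip.U`) and (g) the
`n`-uniform majorant of the weight part of `Ftil`, which — multiplied by the cone bound `‖P̂(k_l)‖ ≤ C_P·n²∕(π−½)²` of the sequel (A2) `PC_bound_cone`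
at the `l ≠ 0` alias points — is the recipe's `‖Ftil‖ ≤ C_A·n^{2D+4}`.  This file needs none of the pending∕staged files (F)(F2)(A)(A2).

CONTENT (`D = d+1`).
* §1 (a) [folklore] `cexp_sub_one_mul_cexp_neg_sub_one` (`(e^{ia} − 1)(e^{−ia} − 1) = S1 a`), `gsum_mul_gsum_neg_mul_S1`
  (`gsum w n·gsum (−w) n·S1 w = S1 (w·n)`), `S1_add_two_pi_mul_nat`, `uFactor_eq_div`, and the IDENTITY
  **`gsum_alias_mul_gsum_neg`**: `Sxi n (z + 2πj) ≠ 0 ∨ (j = 0 ∧ z = 0)` ⟹ `gsum ((z + 2πj)/n) n · gsum (−((z + 2πj)/n)) n = n²·uFactor n j z`.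
* §2 (b) [folklore] `aliasPt_apply'`, **`cweight_alias_mul_cweight_neg`**:
  `cweight n κ (k_l)·cweight n λ (−k_l) = n^{2D}·U n l k·(gsum ((k_l)_κ) n·gsum (−(k_l)_λ) n)` under the coordinatewise hypothesis of (a), and
  **`alias_hyp_of_mem_fat`**: that hypothesis holds at EVERY `l` for `k ∈ Fat D r`, `r ≤ 1/4`; `cweight_alias_mul_cweight_neg_of_mem_fat` (hypothesis-free form).
* §3 (c) [folklore] `aliasPt_im`, **`norm_gsum_aliasPt_le`** ∕ `norm_gsum_neg_aliasPt_le`: `|Im k_i| ≤ κ ⟹ ‖gsum (±(k_l)_i) n‖ ≤ n·e^{κ}`.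
* §4 (g-weights) [folklore] `norm_cweight_alias_mul_le` (termwise), **`sum_norm_cweight_alias_mul_le`**:
  `Σ_l ‖cweight n κ (k_l)‖·‖cweight n λ (−k_l)‖ ≤ 132^D·e^{2κ}·n^{2D+2}` for `k ∈ Fat D r` (`r ≤ 1/4`) with `|Im k_i| ≤ κ`; `…_erase` (the `l ≠ 0` sub-sum)
  and `…_fat` (`κ = 2r`: `132^D·e·n^{2D+2}`); **`norm_sum_erase_cweight_mul_le`**: with ANY symbol `G` bounded by `B` at the `l ≠ 0` alias points,
  `‖Σ_{l≠0} cweight·cweight(−)·G(k_l)‖ ≤ B·132^D·e^{2κ}·n^{2D+2}` (the recipe's `Ftil` bound in one line once (A2) supplies `B`).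
* §5 (d) [folklore] `gsum_div_mul_gsum_neg`, **`norm_gsum_div_ge_of_le`** (generic: `c ≤ ‖uFactor n 0 z‖`, `|Im z| ≤ κ` ⟹ `c·e^{−κ}·n ≤ ‖gsum (z/n) n‖`),
  **`norm_gsum_div_ge_fat`** ∕ `norm_gsum_aliasPt_zero_ge` (`(3/16)·e^{−2r}·n ≤ ‖gsum (z/n) n‖` on the fat box `|Re z| ≤ π + r`, `|Im z| ≤ 2r`,
  `r ≤ 1/4`, from the Literature fat-box letter `Beta.AliasRatioStrip.norm_uFactor_zero_ge` (`3/16 ≤ ‖uFactor n 0 z‖`)) — the `n`-free `D0⁻¹` control.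
NOT HERE: the recipe's (e)(f) (`redist`, file (A)) and (g) with `P̂` (file (A2)); both consume §4 and (A2)'s `PC_bound_cone` in one line each.
Unit `b2b-balaban-t4-ne9-formalise-leaf-04` (gen 35), an idle NE9 seat's detachable slice for road FP row IR-2 (ii); first refusal was offered to the
beta-d1-formalise-leaf-06 lineage and the road-FP owner d1-p3 (journal INTENT l.22834; owner «GO» l.22907).
-/

noncomputable section

namespace Summit.QuantumFields.BalabanUV.Beta.FP.CoarseCovarianceStripAliasWeights

open Complex Finset
open scoped Real BigOperators
open Literature.MathematicalPhysics.QuantumFieldTheory.Balaban1983to89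
open B4Strip (S1 Sxi uFactor U)
open B4StripCauchy (Fat Sxi_shift_ne_zero Sxi_ne_zero sum_norm_U_le)
open B4StripSums (Sxi_eq_sq_mul_S1)
open Summit.QuantumFields.BalabanUV.Beta.GAN24.FibreSymbols (gsum)
open Summit.QuantumFields.BalabanUV.Beta.GAN24.AliasStripSymbolsSum (gsum_mul_sub_one norm_gsum_le_of_im)
open Summit.QuantumFields.BalabanUV.Beta.GAN24.AliasDecimate (aliasPt)
open Summit.QuantumFields.BalabanUV.Beta.GAN24.PushSumSymbol (cweight)
open Summit.QuantumFields.BalabanUV.Beta.FP.CoarseCovarianceAlias (gsum_zero)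

variable {d : ℕ}

/-! ## §1 (a) The one-dimensional identity `gsum w n · gsum (−w) n = n² · uFactor n j z`, `w = (z + 2πj)/n` -/

/-- [folklore] `(e^{ia} − 1)(e^{−ia} − 1) = 2 − 2cos a = S1 a`. -/
theorem cexp_sub_one_mul_cexp_neg_sub_one (a : ℂ) : (cexp (I * a) - 1) * (cexp (-(I * a)) - 1) = S1 a := by
  have e1 : cexp (I * a) * cexp (-(I * a)) = 1 := by
    rw [← Complex.exp_add, add_neg_cancel, Complex.exp_zero]
  have h2 : cexp (I * a) + cexp (-(I * a)) = 2 * Complex.cos a := by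
    rw [Complex.two_cos, neg_mul, mul_comm a I]
  calc (cexp (I * a) - 1) * (cexp (-(I * a)) - 1)
      = cexp (I * a) * cexp (-(I * a)) - (cexp (I * a) + cexp (-(I * a))) + 1 := by ring
    _ = S1 a := by rw [e1, h2]; unfold S1; ring

/-- [folklore] `gsum w n · gsum (−w) n · S1 w = S1 (w·n)` (from `gsum w n·(e^{iw} − 1) = e^{iwn} − 1` and its `−w` twin). -/
theorem gsum_mul_gsum_neg_mul_S1 (w : ℂ) (n : ℕ) : gsum w n * gsum (-w) n * S1 w = S1 (w * n) := by
  have h1 := gsum_mul_sub_one w n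
  have h2 := gsum_mul_sub_one (-w) n
  have e3 : I * (-w) = -(I * w) := by ring
  have e4 : -(I * w) * (n : ℂ) = -(I * (w * n)) := by ring
  have e5 : I * w * n = I * (w * n) := by ring
  rw [e3] at h2
  rw [e4] at h2
  rw [e5] at h1
  calc gsum w n * gsum (-w) n * S1 w
      = (gsum w n * (cexp (I * w) - 1)) * (gsum (-w) n * (cexp (-(I * w)) - 1)) := by
          rw [← cexp_sub_one_mul_cexp_neg_sub_one]; ring
    _ = (cexp (I * (w * n)) - 1) * (cexp (-(I * (w * n))) - 1) := by rw [h1, h2]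
    _ = S1 (w * n) := cexp_sub_one_mul_cexp_neg_sub_one _

/-- [folklore] `S1` is `2π`-periodic: `S1 (z + 2πj) = S1 z`. -/
theorem S1_add_two_pi_mul_nat (z : ℂ) (j : ℕ) : S1 (z + 2 * Real.pi * (j : ℂ)) = S1 z := by
  unfold S1
  have e : z + 2 * (Real.pi : ℂ) * (j : ℂ) = z + (j : ℂ) * (2 * Real.pi) := by ring
  rw [e, Complex.cos_add_nat_mul_two_pi]

/-- [folklore] off the zone centre `uFactor n j z = S1 z / Sxi n (z + 2πj)` (both `j ≠ 0` and `j = 0, z ≠ 0`). -/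
theorem uFactor_eq_div (n j : ℕ) (z : ℂ) (h : ¬ (j = 0 ∧ z = 0)) : uFactor n j z = S1 z / Sxi n (z + 2 * Real.pi * (j : ℂ)) := by
  unfold uFactor
  by_cases hj : j = 0
  · subst hj
    have hz : z ≠ 0 := fun hz => h ⟨rfl, hz⟩
    simp [hz]
  · simp [hj]

/-- [folklore] **(a) THE ONE-DIMENSIONAL ALIAS-WEIGHT IDENTITY**: for `n ≠ 0`, `j ∈ ℕ`, `z ∈ ℂ` with `Sxi n (z + 2πj) ≠ 0` or `(j = 0 ∧ z = 0)`,
`gsum ((z + 2πj)/n) n · gsum (−(z + 2πj)/n) n = n² · uFactor n j z` — the EXACT complex product (`= S1(nw)/S1(w)`), not the modulus: the Literature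
modulus identity `B4StripSums.norm_v_sq` (`‖v‖² = e^{Im z(1−1/n)}‖S1 z‖/‖Sxi n (z+2πj)‖`) carries an exponential factor that the product does not. -/
theorem gsum_alias_mul_gsum_neg {n : ℕ} (hn : n ≠ 0) (j : ℕ) (z : ℂ)
    (h : Sxi n (z + 2 * Real.pi * (j : ℂ)) ≠ 0 ∨ (j = 0 ∧ z = 0)) :
    gsum ((z + 2 * Real.pi * (j : ℂ)) / n) n * gsum (-((z + 2 * Real.pi * (j : ℂ)) / n)) n = (n : ℂ) ^ 2 * uFactor n j z := by
  have hn' : (n : ℂ) ≠ 0 := Nat.cast_ne_zero.mpr hn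
  set X : ℂ := z + 2 * Real.pi * (j : ℂ) with hX
  set w : ℂ := X / n with hw
  by_cases hdeg : j = 0 ∧ z = 0
  · -- the zone centre: `w = 0`, `gsum 0 n = n`, `uFactor n 0 0 = 1`
    obtain ⟨hj, hz⟩ := hdeg
    subst hj; subst hz
    have hw0 : w = 0 := by simp [hw, hX]
    rw [hw0, neg_zero, gsum_zero]
    simp [uFactor]; ring
  · have hS : Sxi n X ≠ 0 := h.resolve_right hdeg
    have hS1w : S1 w ≠ 0 := by
      intro h0
      apply hS
      rw [Sxi_eq_sq_mul_S1, ← hw, h0, mul_zero]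
    have hprod := gsum_mul_gsum_neg_mul_S1 w n
    have hwn : w * n = X := by rw [hw]; field_simp
    rw [hwn, hX, S1_add_two_pi_mul_nat] at hprod
    -- `gsum w·gsum(−w) = S1 z / S1 w = n²·S1 z / Sxi n X`
    have hq : gsum w n * gsum (-w) n = S1 z / S1 w := by
      rw [eq_div_iff hS1w]; exact hprod
    rw [hq, uFactor_eq_div n j z hdeg, ← hX, Sxi_eq_sq_mul_S1, ← hw]
    field_simp

/-! ## §2 (b) The alias-weight identity for `cweight` -/

/-- [folklore] unfolding the alias momentum: `(k_l)_i = (k_i + 2π l_i)/n`. -/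
theorem aliasPt_apply' (n : ℕ) (l : Fin (d + 1) → Fin n) (k : Fin (d + 1) → ℂ) (i : Fin (d + 1)) :
    aliasPt n l k i = (k i + 2 * Real.pi * ((l i : ℕ) : ℂ)) / n := rfl

/-- [folklore] **(b) THE ALIAS-WEIGHT IDENTITY**: at the alias momentum `k_l = (k + 2πl)/n`,
`cweight n κ (k_l) · cweight n λ (−k_l) = n^{2D} · U n l k · (gsum ((k_l)_κ) n · gsum (−(k_l)_λ) n)` (`D = d+1`), whenever coordinatewise
`Sxi n (k_i + 2π l_i) ≠ 0` or `(l_i = 0 ∧ k_i = 0)`. -/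
theorem cweight_alias_mul_cweight_neg {n : ℕ} [NeZero n] (κ l' : Fin (d + 1)) (l : Fin (d + 1) → Fin n) (k : Fin (d + 1) → ℂ)
    (h : ∀ i, Sxi n (k i + 2 * Real.pi * ((l i : ℕ) : ℂ)) ≠ 0 ∨ ((l i : ℕ) = 0 ∧ k i = 0)) :
    cweight n κ (aliasPt n l k) * cweight n l' (-aliasPt n l k)
      = (n : ℂ) ^ (2 * (d + 1)) * U n l k * (gsum (aliasPt n l k κ) n * gsum (-(aliasPt n l k l')) n) := by
  have hn : n ≠ 0 := NeZero.ne n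
  have hfac : ∀ i, gsum (aliasPt n l k i) n * gsum ((-aliasPt n l k) i) n = (n : ℂ) ^ 2 * uFactor n (l i : ℕ) (k i) := by
    intro i
    rw [Pi.neg_apply, aliasPt_apply']
    exact gsum_alias_mul_gsum_neg hn (l i : ℕ) (k i) (h i)
  have hprod : (∏ i, gsum (aliasPt n l k i) n) * (∏ i, gsum ((-aliasPt n l k) i) n) = (n : ℂ) ^ (2 * (d + 1)) * U n l k := by
    rw [← Finset.prod_mul_distrib, Finset.prod_congr rfl fun i _ => hfac i, Finset.prod_mul_distrib, Finset.prod_const,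
      Finset.card_univ, Fintype.card_fin, ← pow_mul, mul_comm 2 (d + 1)]
    rfl
  unfold cweight
  rw [Pi.neg_apply]
  calc (∏ i, gsum (aliasPt n l k i) n) * gsum (aliasPt n l k κ) n * ((∏ i, gsum ((-aliasPt n l k) i) n) * gsum (-aliasPt n l k l') n)
      = ((∏ i, gsum (aliasPt n l k i) n) * (∏ i, gsum ((-aliasPt n l k) i) n)) * (gsum (aliasPt n l k κ) n * gsum (-aliasPt n l k l') n) := by ring
    _ = (n : ℂ) ^ (2 * (d + 1)) * U n l k * (gsum (aliasPt n l k κ) n * gsum (-aliasPt n l k l') n) := by rw [hprod]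

/-- [folklore] **THE HYPOTHESIS OF (b) HOLDS ON THE FAT STRIP**: for `k ∈ Fat D r`, `r ≤ 1/4`, and every `l ∈ {0,…,n−1}^D`, coordinatewise
`Sxi n (k_i + 2π l_i) ≠ 0` or `(l_i = 0 ∧ k_i = 0)` (`Sxi_shift_ne_zero` for `l_i ≠ 0`; `Sxi_ne_zero` for `l_i = 0`, `k_i ≠ 0`, since `|Re k_i| ≤ π + ¼ < 2π`). -/
theorem alias_hyp_of_mem_fat {n : ℕ} [NeZero n] {r : ℝ} (hr : r ≤ 1 / 4) {k : Fin (d + 1) → ℂ} (hk : k ∈ Fat (d + 1) r)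
    (l : Fin (d + 1) → Fin n) (i : Fin (d + 1)) :
    Sxi n (k i + 2 * Real.pi * ((l i : ℕ) : ℂ)) ≠ 0 ∨ ((l i : ℕ) = 0 ∧ k i = 0) := by
  have hn1 : 1 ≤ n := Nat.one_le_iff_ne_zero.mpr (NeZero.ne n)
  by_cases hl : (l i : ℕ) = 0
  · by_cases hz : k i = 0
    · exact Or.inr ⟨hl, hz⟩
    · left
      rw [hl, Nat.cast_zero, mul_zero, add_zero]
      refine Sxi_ne_zero n hn1 ?_ hz
      have h1 := (hk i).1
      have hπ3 := Real.pi_gt_three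
      linarith
  · left
    exact Sxi_shift_ne_zero n (l i : ℕ) (Nat.one_le_iff_ne_zero.mpr hl) (l i).isLt hr (hk i).1

/-- [folklore] (b) on the fat strip, hypothesis-free. -/
theorem cweight_alias_mul_cweight_neg_of_mem_fat {n : ℕ} [NeZero n] {r : ℝ} (hr : r ≤ 1 / 4) {k : Fin (d + 1) → ℂ}
    (hk : k ∈ Fat (d + 1) r) (κ l' : Fin (d + 1)) (l : Fin (d + 1) → Fin n) :
    cweight n κ (aliasPt n l k) * cweight n l' (-aliasPt n l k)
      = (n : ℂ) ^ (2 * (d + 1)) * U n l k * (gsum (aliasPt n l k κ) n * gsum (-(aliasPt n l k l')) n) :=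
  cweight_alias_mul_cweight_neg κ l' l k (alias_hyp_of_mem_fat hr hk l)

/-! ## §3 (c) The strip bound of one geometric-sum factor at an alias momentum -/

/-- [folklore] the imaginary part of an alias momentum: `Im (k_l)_i = Im k_i / n`. -/
theorem aliasPt_im (n : ℕ) (l : Fin (d + 1) → Fin n) (k : Fin (d + 1) → ℂ) (i : Fin (d + 1)) :
    (aliasPt n l k i).im = (k i).im / n := by
  rw [aliasPt_apply', Complex.div_natCast_im]
  simp

/-- [folklore] **(c)** `|Im k_i| ≤ κ ⟹ ‖gsum ((k_l)_i) n‖ ≤ n·e^{κ}` (`norm_gsum_le_of_im` with `ρ := κ`: `|Im (k_l)_i|·n = |Im k_i| ≤ κ`). -/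
theorem norm_gsum_aliasPt_le {n : ℕ} [NeZero n] (l : Fin (d + 1) → Fin n) {k : Fin (d + 1) → ℂ} {κ : ℝ} {i : Fin (d + 1)}
    (hk : |(k i).im| ≤ κ) : ‖gsum (aliasPt n l k i) n‖ ≤ n * Real.exp κ := by
  refine norm_gsum_le_of_im _ n ?_
  have hn : (n : ℝ) ≠ 0 := Nat.cast_ne_zero.mpr (NeZero.ne n)
  rw [aliasPt_im, abs_div, Nat.abs_cast, div_mul_cancel₀ _ hn]
  exact hk

/-- [folklore] (c) for the reflected momentum: `‖gsum (−(k_l)_i) n‖ ≤ n·e^{κ}`. -/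
theorem norm_gsum_neg_aliasPt_le {n : ℕ} [NeZero n] (l : Fin (d + 1) → Fin n) {k : Fin (d + 1) → ℂ} {κ : ℝ} {i : Fin (d + 1)}
    (hk : |(k i).im| ≤ κ) : ‖gsum (-(aliasPt n l k i)) n‖ ≤ n * Real.exp κ := by
  refine norm_gsum_le_of_im _ n ?_
  have hn : (n : ℝ) ≠ 0 := Nat.cast_ne_zero.mpr (NeZero.ne n)
  rw [Complex.neg_im, abs_neg, aliasPt_im, abs_div, Nat.abs_cast, div_mul_cancel₀ _ hn]
  exact hk

/-! ## §4 (g-weights) The `P̂`-free alias majorant -/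

/-- [folklore] TERMWISE: `‖cweight n κ (k_l)‖·‖cweight n λ (−k_l)‖ ≤ n^{2D}·(n·e^{κ})²·‖U n l k‖` on the fat strip with `|Im k_i| ≤ κ`. -/
theorem norm_cweight_alias_mul_le {n : ℕ} [NeZero n] {r : ℝ} (hr : r ≤ 1 / 4) {k : Fin (d + 1) → ℂ} (hk : k ∈ Fat (d + 1) r)
    {κ₀ : ℝ} (hκ : ∀ i, |(k i).im| ≤ κ₀) (κ l' : Fin (d + 1)) (l : Fin (d + 1) → Fin n) :
    ‖cweight n κ (aliasPt n l k)‖ * ‖cweight n l' (-aliasPt n l k)‖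
      ≤ (n : ℝ) ^ (2 * (d + 1)) * ((n : ℝ) * Real.exp κ₀) ^ 2 * ‖U n l k‖ := by
  rw [← norm_mul, cweight_alias_mul_cweight_neg_of_mem_fat hr hk κ l' l, norm_mul, norm_mul, norm_mul, norm_pow, Complex.norm_natCast]
  have h1 := norm_gsum_aliasPt_le l (i := κ) (hκ κ)
  have h2 := norm_gsum_neg_aliasPt_le l (i := l') (hκ l')
  have hg : ‖gsum (aliasPt n l k κ) n‖ * ‖gsum (-aliasPt n l k l') n‖ ≤ ((n : ℝ) * Real.exp κ₀) ^ 2 := by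
    rw [sq]
    exact mul_le_mul h1 h2 (norm_nonneg _) (by positivity)
  have hU : 0 ≤ ‖U n l k‖ := norm_nonneg _
  calc (n : ℝ) ^ (2 * (d + 1)) * ‖U n l k‖ * (‖gsum (aliasPt n l k κ) n‖ * ‖gsum (-aliasPt n l k l') n‖)
      ≤ (n : ℝ) ^ (2 * (d + 1)) * ‖U n l k‖ * (((n : ℝ) * Real.exp κ₀) ^ 2) :=
        mul_le_mul_of_nonneg_left hg (by positivity)
    _ = (n : ℝ) ^ (2 * (d + 1)) * ((n : ℝ) * Real.exp κ₀) ^ 2 * ‖U n l k‖ := by ring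

/-- [folklore] **(g-weights) THE `P̂`-FREE ALIAS MAJORANT**: for `k ∈ Fat D r` (`r ≤ 1/4`) with `|Im k_i| ≤ κ` for all `i`,
`Σ_{l ∈ {0,…,n−1}^D} ‖cweight n κ (k_l)‖·‖cweight n λ (−k_l)‖ ≤ 132^D · e^{2κ} · n^{2D+2}` (`B4StripCauchy.sum_norm_U_le`: `Σ_l ‖U n l k‖ ≤ 132^D`). -/
theorem sum_norm_cweight_alias_mul_le {n : ℕ} [NeZero n] {r : ℝ} (hr : r ≤ 1 / 4) {k : Fin (d + 1) → ℂ} (hk : k ∈ Fat (d + 1) r)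
    {κ₀ : ℝ} (hκ : ∀ i, |(k i).im| ≤ κ₀) (κ l' : Fin (d + 1)) :
    ∑ l : Fin (d + 1) → Fin n, ‖cweight n κ (aliasPt n l k)‖ * ‖cweight n l' (-aliasPt n l k)‖
      ≤ 132 ^ (d + 1) * Real.exp (2 * κ₀) * (n : ℝ) ^ (2 * (d + 1) + 2) := by
  have hsum := sum_norm_U_le n hr hk
  calc ∑ l : Fin (d + 1) → Fin n, ‖cweight n κ (aliasPt n l k)‖ * ‖cweight n l' (-aliasPt n l k)‖
      ≤ ∑ l : Fin (d + 1) → Fin n, (n : ℝ) ^ (2 * (d + 1)) * ((n : ℝ) * Real.exp κ₀) ^ 2 * ‖U n l k‖ :=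
        Finset.sum_le_sum fun l _ => norm_cweight_alias_mul_le hr hk hκ κ l' l
    _ = (n : ℝ) ^ (2 * (d + 1)) * ((n : ℝ) * Real.exp κ₀) ^ 2 * ∑ l : Fin (d + 1) → Fin n, ‖U n l k‖ := by rw [Finset.mul_sum]
    _ ≤ (n : ℝ) ^ (2 * (d + 1)) * ((n : ℝ) * Real.exp κ₀) ^ 2 * 132 ^ (d + 1) := mul_le_mul_of_nonneg_left hsum (by positivity)
    _ = 132 ^ (d + 1) * Real.exp (2 * κ₀) * (n : ℝ) ^ (2 * (d + 1) + 2) := by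
        rw [mul_pow, ← Real.exp_nat_mul]; push_cast; ring

/-- [folklore] … and the `l ≠ 0` SUB-SUM (the weight part of the recipe's `Ftil`) obeys the same bound. -/
theorem sum_norm_cweight_alias_mul_le_erase {n : ℕ} [NeZero n] {r : ℝ} (hr : r ≤ 1 / 4) {k : Fin (d + 1) → ℂ} (hk : k ∈ Fat (d + 1) r)
    {κ₀ : ℝ} (hκ : ∀ i, |(k i).im| ≤ κ₀) (κ l' : Fin (d + 1)) :
    ∑ l ∈ Finset.univ.erase (fun _ => (0 : Fin n)), ‖cweight n κ (aliasPt n l k)‖ * ‖cweight n l' (-aliasPt n l k)‖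
      ≤ 132 ^ (d + 1) * Real.exp (2 * κ₀) * (n : ℝ) ^ (2 * (d + 1) + 2) :=
  (Finset.sum_le_sum_of_subset_of_nonneg (Finset.erase_subset _ _) fun _ _ _ => mul_nonneg (norm_nonneg _) (norm_nonneg _)).trans
    (sum_norm_cweight_alias_mul_le hr hk hκ κ l')

/-- [folklore] **(g) WITH AN ABSTRACT SYMBOL**: any `G` bounded by `B` at the `l ≠ 0` alias points of `k` (for the road: `G = P̂_{κλ}`, `B = C_P·n²∕(π−r)²`
from the sequel's cone theorem) gives `‖Σ_{l≠0} cweight n κ (k_l)·cweight n λ (−k_l)·G(k_l)‖ ≤ B·132^D·e^{2κ}·n^{2D+2}` — the recipe's `Ftil` bound in one line. -/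
theorem norm_sum_erase_cweight_mul_le {n : ℕ} [NeZero n] {r : ℝ} (hr : r ≤ 1 / 4) {k : Fin (d + 1) → ℂ} (hk : k ∈ Fat (d + 1) r)
    {κ₀ : ℝ} (hκ : ∀ i, |(k i).im| ≤ κ₀) (κ l' : Fin (d + 1)) (G : (Fin (d + 1) → ℂ) → ℂ) {B : ℝ} (hB : 0 ≤ B)
    (hG : ∀ l : Fin (d + 1) → Fin n, l ≠ (fun _ => 0) → ‖G (aliasPt n l k)‖ ≤ B) :
    ‖∑ l ∈ Finset.univ.erase (fun _ => (0 : Fin n)), cweight n κ (aliasPt n l k) * cweight n l' (-aliasPt n l k) * G (aliasPt n l k)‖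
      ≤ B * (132 ^ (d + 1) * Real.exp (2 * κ₀) * (n : ℝ) ^ (2 * (d + 1) + 2)) := by
  calc ‖∑ l ∈ Finset.univ.erase (fun _ => (0 : Fin n)), cweight n κ (aliasPt n l k) * cweight n l' (-aliasPt n l k) * G (aliasPt n l k)‖
      ≤ ∑ l ∈ Finset.univ.erase (fun _ => (0 : Fin n)), ‖cweight n κ (aliasPt n l k) * cweight n l' (-aliasPt n l k) * G (aliasPt n l k)‖ :=
        norm_sum_le _ _
    _ ≤ ∑ l ∈ Finset.univ.erase (fun _ => (0 : Fin n)), ‖cweight n κ (aliasPt n l k)‖ * ‖cweight n l' (-aliasPt n l k)‖ * B := by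
        refine Finset.sum_le_sum fun l hl => ?_
        rw [norm_mul, norm_mul]
        exact mul_le_mul_of_nonneg_left (hG l (Finset.ne_of_mem_erase hl)) (by positivity)
    _ = B * ∑ l ∈ Finset.univ.erase (fun _ => (0 : Fin n)), ‖cweight n κ (aliasPt n l k)‖ * ‖cweight n l' (-aliasPt n l k)‖ := by
        rw [Finset.mul_sum]
        exact Finset.sum_congr rfl fun l _ => by ring
    _ ≤ B * (132 ^ (d + 1) * Real.exp (2 * κ₀) * (n : ℝ) ^ (2 * (d + 1) + 2)) :=
        mul_le_mul_of_nonneg_left (sum_norm_cweight_alias_mul_le_erase hr hk hκ κ l') hB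

/-- [folklore] on the fat strip itself (`|Im k_i| ≤ 2r ≤ ½`) the majorant reads `132^D · e · n^{2D+2}`. -/
theorem sum_norm_cweight_alias_mul_le_fat {n : ℕ} [NeZero n] {r : ℝ} (hr : r ≤ 1 / 4) {k : Fin (d + 1) → ℂ} (hk : k ∈ Fat (d + 1) r)
    (κ l' : Fin (d + 1)) :
    ∑ l : Fin (d + 1) → Fin n, ‖cweight n κ (aliasPt n l k)‖ * ‖cweight n l' (-aliasPt n l k)‖
      ≤ 132 ^ (d + 1) * Real.exp 1 * (n : ℝ) ^ (2 * (d + 1) + 2) := by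
  refine (sum_norm_cweight_alias_mul_le hr hk (κ₀ := 2 * r) (fun i => (hk i).2) κ l').trans ?_
  have h : Real.exp (2 * (2 * r)) ≤ Real.exp 1 := Real.exp_le_exp.mpr (by linarith)
  exact mul_le_mul_of_nonneg_right (mul_le_mul_of_nonneg_left h (by positivity)) (by positivity)

/-! ## §5 (d) The LOWER bound of the `l = 0` factor: `‖gsum (z/n) n‖ ≥ c·e^{−κ}·n` from `c ≤ ‖uFactor n 0 z‖` -/

/-- [folklore] (a) at `l = 0`: `gsum (z/n) n · gsum (−(z/n)) n = n²·uFactor n 0 z` whenever `Sxi n z ≠ 0` or `z = 0`. -/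
theorem gsum_div_mul_gsum_neg {n : ℕ} (hn : n ≠ 0) (z : ℂ) (h : Sxi n z ≠ 0 ∨ z = 0) :
    gsum (z / n) n * gsum (-(z / n)) n = (n : ℂ) ^ 2 * uFactor n 0 z := by
  have h0 := gsum_alias_mul_gsum_neg hn 0 z (by
    rcases h with h | h
    · left; simpa using h
    · exact Or.inr ⟨rfl, h⟩)
  simpa using h0

/-- [folklore] **(d) GENERIC**: a lower bound `c ≤ ‖uFactor n 0 z‖` and `|Im z| ≤ κ` give `c·e^{−κ}·n ≤ ‖gsum (z/n) n‖` (`n ≥ 1`, `Sxi n z ≠ 0` or `z = 0`) —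
from `‖gsum (z/n)‖·‖gsum (−z/n)‖ = n²‖uFactor n 0 z‖ ≥ c·n²` and `‖gsum (−z/n) n‖ ≤ n·e^{κ}`. -/
theorem norm_gsum_div_ge_of_le {n : ℕ} (hn : 1 ≤ n) {z : ℂ} {κ₀ c : ℝ} (hS : Sxi n z ≠ 0 ∨ z = 0)
    (hc : c ≤ ‖uFactor n 0 z‖) (hκ : |z.im| ≤ κ₀) : c * Real.exp (-κ₀) * n ≤ ‖gsum (z / n) n‖ := by
  have hn0 : n ≠ 0 := by omega
  have hnr : (0 : ℝ) < n := by exact_mod_cast (show 0 < n by omega)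
  have hprod : ‖gsum (z / n) n‖ * ‖gsum (-(z / n)) n‖ = (n : ℝ) ^ 2 * ‖uFactor n 0 z‖ := by
    rw [← norm_mul, gsum_div_mul_gsum_neg hn0 z hS, norm_mul, norm_pow, Complex.norm_natCast]
  have hb : ‖gsum (-(z / n)) n‖ ≤ n * Real.exp κ₀ := by
    refine norm_gsum_le_of_im _ n ?_
    rw [Complex.neg_im, abs_neg, Complex.div_natCast_im, abs_div, Nat.abs_cast, div_mul_cancel₀ _ hnr.ne']
    exact hκ
  have hB : 0 < (n : ℝ) * Real.exp κ₀ := by positivity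
  refine le_of_mul_le_mul_right ?_ hB
  have e : c * Real.exp (-κ₀) * n * (n * Real.exp κ₀) = (n : ℝ) ^ 2 * c := by
    rw [Real.exp_neg]; field_simp
  rw [e]
  calc (n : ℝ) ^ 2 * c ≤ (n : ℝ) ^ 2 * ‖uFactor n 0 z‖ := mul_le_mul_of_nonneg_left hc (by positivity)
    _ = ‖gsum (z / n) n‖ * ‖gsum (-(z / n)) n‖ := hprod.symm
    _ ≤ ‖gsum (z / n) n‖ * (n * Real.exp κ₀) := mul_le_mul_of_nonneg_left hb (norm_nonneg _)

/-- [folklore] **(d) ON THE FAT BOX**: `r ≤ 1/4`, `|Re z| ≤ π + r`, `|Im z| ≤ 2r`, `n ≥ 1` ⟹ `(3/16)·e^{−2r}·n ≤ ‖gsum (z/n) n‖` — the Literature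
fat-box lower bound `Beta.AliasRatioStrip.norm_uFactor_zero_ge` (`3/16 ≤ ‖uFactor n 0 z‖`) through (a); the `n`-free control of `D0⁻¹` in the recipe's step (3). -/
theorem norm_gsum_div_ge_fat {n : ℕ} (hn : 1 ≤ n) {z : ℂ} {r : ℝ} (hr : r ≤ 1 / 4) (hx : |z.re| ≤ Real.pi + r)
    (hy : |z.im| ≤ 2 * r) : 3 / 16 * Real.exp (-(2 * r)) * n ≤ ‖gsum (z / n) n‖ := by
  have hS : Sxi n z ≠ 0 ∨ z = 0 := by
    by_cases hz : z = 0
    · exact Or.inr hz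
    · exact Or.inl (Sxi_ne_zero n hn (by linarith [Real.pi_gt_three]) hz)
  exact norm_gsum_div_ge_of_le hn hS (Beta.AliasRatioStrip.norm_uFactor_zero_ge n hn hr hx hy) hy

/-- [folklore] (d) at the `l = 0` alias momentum of a coarse momentum `k ∈ Fat D r` (`r ≤ 1/4`):
`(3/16)·e^{−2r}·n ≤ ‖gsum (aliasPt n 0 k i) n‖` for every coordinate `i`. -/
theorem norm_gsum_aliasPt_zero_ge {n : ℕ} [NeZero n] {r : ℝ} (hr : r ≤ 1 / 4) {k : Fin (d + 1) → ℂ}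
    (hk : k ∈ Fat (d + 1) r) (i : Fin (d + 1)) :
    3 / 16 * Real.exp (-(2 * r)) * n ≤ ‖gsum (aliasPt n (fun _ => (0 : Fin n)) k i) n‖ := by
  have e : aliasPt n (fun _ => (0 : Fin n)) k i = k i / n := by
    rw [aliasPt_apply']; simp
  rw [e]
  exact norm_gsum_div_ge_fat (Nat.one_le_iff_ne_zero.mpr (NeZero.ne n)) hr (hk i).1 (hk i).2

end Summit.QuantumFields.BalabanUV.Beta.FP.CoarseCovarianceStripAliasWeights

end
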